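import Summits.BirchSwinnertonDyer.BirchSwinnertonDyer.Statement
import Literature.NumberTheory.EllipticCurves.LeadingTerm
import Literature.NumberTheory.EllipticCurves.KatoRankBoundProofs
import Literature.NumberTheory.EllipticCurves.BSDInvariantsProofs
import Literature.NumberTheory.EllipticCurves.GlobalMinimalModelProofs
import Literature.NumberTheory.DiophantineGeometry.Conductor
import HarnessLib.Audit.Tags

/-!
# Solo (blind) — the `p`-adic squeeze: `rank ≤ ord_{s=1} L` from ONE-SIDED order transfer

Second kernel-checked reduction of the soloist programme `solo-BirchSwinnertonDyer-blind`
(companion of `SoloBlindCellDecomposition`).  The summit `BirchSwinnertonDyer` is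
`∀ E/ℚ, ord_{s=1} L(E,s) = rank E(ℚ)`; write `a = analyticRank`, `r = mordellWeilRank`.
`SoloBlindCellDecomposition.bsd_iff_upper_and_lower` splits it into the two inequalities
`r ≤ a` (`UpperBound`) and `a ≤ r` (`LowerBound`).  This file proves, sorry-free and over NAMED
Literature facts only, that the first inequality is implied by a statement living entirely on the
`p`-adic side at ONE auxiliary prime per curve:

* `OrderTransferLE` (tagged `@[conjecture]`, the wall W3⁻ of the programme's census): for every
  elliptic curve `E/ℚ` (globally minimal equation) and its newform `f` there is SOME odd good
  ordinary prime `p` at which `ord_{T=0} L_p(E,T) ≤ ord_{s=1} L(E,s)` — the cyclotomic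
  Mazur–Swinnerton-Dyer `p`-adic `L`-function `padicLFunction f (unitRoot W p)` does not vanish at
  `T = 0` to higher order than the complex `L`-function does at `s = 1`.

* `mordellWeilRank_le_analyticRank_of_orderTransferLE`: Kato's rank bound
  `rank E(ℚ) ≤ ord_{T=0} L_p(E,T)` (Kato 2004, Thm. 18.4 — the tree fact
  `kato_mordellWeilRank_le_order_padicLFunction`, itself a tree THEOREM from Kato's divisibility
  `kato_divisibility`, Thm. 17.4, by `kato_mordellWeilRank_le_order_padicLFunction_of_kato_divisibility`)
  + modularity (`exists_isNewformOf`, Breuil–Conrad–Diamond–Taylor) + `OrderTransferLE`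
  `⟹ ∀ E/ℚ, rank E(ℚ) ≤ ord_{s=1} L(E,s)`.  Global minimal models (Néron; tree theorem
  `hasGlobalMinimalModel_rat_holds`) and the invariance of both ranks under admissible changes of
  variables (tree theorems `mordellWeilRank_variableChange_holds`, `analyticRank_variableChange_holds`)
  remove the minimality assumption.

* `bsd_of_orderTransferLE_of_lowerBound`: hence `BirchSwinnertonDyer ⟸ OrderTransferLE ∧ (a ≤ r)`,
  and with Gross–Zagier–Kolyvagin (`rank_eq_analyticRank_of_analyticRank_le_one`) the lower bound is
  only needed in the regime `2 ≤ a` (`bsd_of_orderTransferLE_of_lowerBoundHigh`).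

* the transfer is only NEEDED for curves with `rank E(ℚ) ≥ 3` and `ord_{s=1} L ≥ 2`
  (`OrderTransferLEHigh`): given GZK, `rank ≤ a` already holds whenever `rank ≤ 2` or `a ≤ 1`
  (`mordellWeilRank_le_analyticRank_of_orderTransferLE`).

Why this is the sharp form of the wall.  The converse inequality `ord_{s=1} L ≤ ord_{T=0} L_p` in
ranks `≤ 1` is Kato + Perrin-Riou/Schneider (p-adic Gross–Zagier), and `rank ≤ ord L_p` is Kato for
every rank; what NO known method gives, at any order of vanishing `≥ 2`, is a bound of the complex
order FROM BELOW by the `p`-adic order (or by anything algebraic).  `OrderTransferLE` isolates exactly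
that: it asks for no equality, no non-degeneracy of `p`-adic heights, no finiteness of `Ш`, and only
one prime per curve.  It is implied by (BSD ∧ `Ш(E)[p^∞]` finite ∧ Schneider non-degeneracy ∧ the
Iwasawa main conjecture at one good ordinary `p`), so it is not stronger than the standard package;
and it is NOT a consequence of `BirchSwinnertonDyer` alone (the rank conjecture says nothing about
`L_p`).  Sources: Kato, Astérisque 295 (2004), Thm. 17.4, 18.4; Mazur–Tate–Teitelbaum, Invent.
Math. 84 (1986) §II.18–19 (the `p`-adic BSD conjecture `ord_T L_p = rank`, non-exceptional case);
Schneider, Invent. Math. 79 (1985); Perrin-Riou, Invent. Math. 89 (1987); Greenberg, LNM 1716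
(1999) §4 (held: `book:coates1999-arithmetic-theory-elliptic-curves`, p. 110–111).
-/

set_option linter.dupNamespace false

open scoped MatrixGroups ModularForm
open CongruenceSubgroup Literature.NumberTheory.EllipticCurves
  Literature.NumberTheory.EllipticCurves.ModularForms WeierstrassCurve

namespace Summit.BirchSwinnertonDyer.BirchSwinnertonDyer.Theorems.SoloBlind

/-- **One-sided order transfer at one odd good ordinary prime** (wall W3⁻ of the solo census;
OPEN — the `≤` half, at `T = 0` / `s = 1`, of the Mazur–Tate–Teitelbaum `p`-adic BSD comparison
`ord_{T=0} L_p(E,T) = ord_{s=1} L(E,s)` in the non-exceptional (good ordinary) case): for every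
elliptic curve `E/ℚ` given by a globally minimal equation `W` and every weight-2 newform `f` with
`IsNewformOf W f`, there is an odd prime `p` of good ordinary reduction such that
`ord_{T=0} L_p(f, α_p, T) ≤ ord_{s=1} L(E, s)`, `α_p = unitRoot W p`.
[cite: MazurTateTeitelbaum1986Invent, §II.18–19 (the conjecture "BSD(p)": ord = rank, non-exceptional case)] -/
@[conjecture] def OrderTransferLE : Prop :=
  ∀ (W : WeierstrassCurve ℚ) [W.IsElliptic] [W.IsGloballyMinimal] {N : ℕ} [NeZero N]
    (f : CuspForm (Gamma0 N) 2), IsNewformOf W f →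
      ∃ (p : ℕ) (_ : Fact p.Prime), p ≠ 2 ∧ IsOrdinaryAt W p ∧
        (padicLFunction f (unitRoot W p : ℚ_[p])).order ≤ (W.analyticRank : ℕ∞)

/-- The same transfer asked only where it is needed (see
`mordellWeilRank_le_analyticRank_of_orderTransferLE_high`): curves with `rank E(ℚ) ≥ 3` and
`ord_{s=1} L(E,s) ≥ 2`. [cite: MazurTateTeitelbaum1986Invent, §II.18–19] -/
@[conjecture] def OrderTransferLEHigh : Prop :=
  ∀ (W : WeierstrassCurve ℚ) [W.IsElliptic] [W.IsGloballyMinimal] {N : ℕ} [NeZero N]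
    (f : CuspForm (Gamma0 N) 2), IsNewformOf W f → 3 ≤ W.mordellWeilRank → 2 ≤ W.analyticRank →
      ∃ (p : ℕ) (_ : Fact p.Prime), p ≠ 2 ∧ IsOrdinaryAt W p ∧
        (padicLFunction f (unitRoot W p : ℚ_[p])).order ≤ (W.analyticRank : ℕ∞)

section Squeeze

-- `hKato`: Kato's rank bound, Astérisque 295, Thm. 18.4, at every odd good ordinary prime (tree
-- fact; a tree theorem from `kato_divisibility` by
-- `kato_mordellWeilRank_le_order_padicLFunction_of_kato_divisibility`).
-- `hmod`: modularity with level = conductor (Breuil–Conrad–Diamond–Taylor; Carayol).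


/-- **The squeeze on a globally minimal model.** Kato's `rank ≤ ord_T L_p` and the transfer
`ord_T L_p ≤ ord_s L` at the prime supplied by `OrderTransferLEHigh` give `rank ≤ ord_{s=1} L`
for curves with `rank ≥ 3`, `a ≥ 2`. [cite: Kato2004, Thm 18.4 (p. 281)] -/
theorem mordellWeilRank_le_analyticRank_of_isGloballyMinimal_high
    (hKato : ∀ (W : WeierstrassCurve ℚ) [W.IsElliptic] [W.IsGloballyMinimal] (p : ℕ)
      [Fact p.Prime] {N : ℕ} [NeZero N] {f : CuspForm (Gamma0 N) 2},
      kato_mordellWeilRank_le_order_padicLFunction W p (f := f))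
    (hmod : exists_isNewformOf)
    (hOT : OrderTransferLEHigh)
    (W : WeierstrassCurve ℚ) [W.IsElliptic] [W.IsGloballyMinimal]
    (hr : 3 ≤ W.mordellWeilRank) (ha : 2 ≤ W.analyticRank) :
    W.mordellWeilRank ≤ W.analyticRank := by
  haveI : NeZero (W.conductorNorm ℤ) := ⟨(W.conductorNorm_pos_holds).ne'⟩
  obtain ⟨f, hf⟩ := hmod W
  obtain ⟨p, hp, hp2, hord, hle⟩ := hOT W f hf hr ha
  have hk : (W.mordellWeilRank : ℕ∞) ≤ (padicLFunction f (unitRoot W p : ℚ_[p])).order :=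
    hKato W p hp2 hord hf
  exact_mod_cast hk.trans hle

/-- Reduction of a statement about `(rank, analyticRank)` of all elliptic `W/ℚ` to globally
minimal equations (Néron's global minimal model + invariance of both ranks under admissible
changes of variables; all three tree theorems). [folklore] -/
theorem forall_of_forall_isGloballyMinimal
    (P : ℕ → ℕ → Prop)
    (h : ∀ (W : WeierstrassCurve ℚ) [W.IsElliptic] [W.IsGloballyMinimal],
      P W.mordellWeilRank W.analyticRank)
    (W : WeierstrassCurve ℚ) [W.IsElliptic] : P W.mordellWeilRank W.analyticRank := by
  obtain ⟨C, hC⟩ := hasGlobalMinimalModel_rat_holds W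
  have h1 := h (C • W)
  rwa [show (C • W).mordellWeilRank = W.mordellWeilRank from mordellWeilRank_variableChange_holds W C,
    show (C • W).analyticRank = W.analyticRank from analyticRank_variableChange_holds W C] at h1

/-- **`UpperBound` in the high regime from the one-sided transfer**, for every equation. -/
theorem mordellWeilRank_le_analyticRank_of_orderTransferLE_high
    (hKato : ∀ (W : WeierstrassCurve ℚ) [W.IsElliptic] [W.IsGloballyMinimal] (p : ℕ)
      [Fact p.Prime] {N : ℕ} [NeZero N] {f : CuspForm (Gamma0 N) 2},
      kato_mordellWeilRank_le_order_padicLFunction W p (f := f))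
    (hmod : exists_isNewformOf)
    (hOT : OrderTransferLEHigh)
    (W : WeierstrassCurve ℚ) [W.IsElliptic]
    (hr : 3 ≤ W.mordellWeilRank) (ha : 2 ≤ W.analyticRank) :
    W.mordellWeilRank ≤ W.analyticRank :=
  forall_of_forall_isGloballyMinimal (fun r a => 3 ≤ r → 2 ≤ a → r ≤ a)
    (fun V _ _ => mordellWeilRank_le_analyticRank_of_isGloballyMinimal_high hKato hmod hOT V) W hr ha

/-- GZK unpacked (`hGZK`: Gross–Zagier–Kolyvagin, tree fact): `a(E) ≤ 1 → r(E) = a(E)`. -/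
theorem rank_eq_of_le_one
    (hGZK : rank_eq_analyticRank_of_analyticRank_le_one)
    (W : WeierstrassCurve ℚ) [W.IsElliptic]
    (h : W.analyticRank ≤ 1) : W.mordellWeilRank = W.analyticRank :=
  (hGZK W h).1

/-- **`UpperBound` from the one-sided transfer (needed only for `rank ≥ 3`, `a ≥ 2`).**
`∀ E/ℚ, rank E(ℚ) ≤ ord_{s=1} L(E,s)` from Kato's rank bound, modularity, Gross–Zagier–Kolyvagin
and `OrderTransferLEHigh`. [cite: Kato2004, Thm 18.4 (p. 281)] -/
theorem mordellWeilRank_le_analyticRank_of_orderTransferLE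
    (hKato : ∀ (W : WeierstrassCurve ℚ) [W.IsElliptic] [W.IsGloballyMinimal] (p : ℕ)
      [Fact p.Prime] {N : ℕ} [NeZero N] {f : CuspForm (Gamma0 N) 2},
      kato_mordellWeilRank_le_order_padicLFunction W p (f := f))
    (hmod : exists_isNewformOf)
    (hGZK : rank_eq_analyticRank_of_analyticRank_le_one)
    (hOT : OrderTransferLEHigh)
    (W : WeierstrassCurve ℚ) (hE : W.IsElliptic) : W.mordellWeilRank ≤ W.analyticRank := by
  by_cases ha : W.analyticRank ≤ 1
  · exact (rank_eq_of_le_one hGZK W ha).le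
  by_cases hr : W.mordellWeilRank ≤ 2
  · omega
  exact mordellWeilRank_le_analyticRank_of_orderTransferLE_high hKato hmod hOT W (by omega) (by omega)

/-- **The summit from the one-sided transfer and the lower bound in the high regime.**
`BirchSwinnertonDyer ⟸ OrderTransferLEHigh ∧ (∀ E, 2 ≤ ord L ⟹ ord L ≤ rank)`, over Kato,
modularity and Gross–Zagier–Kolyvagin. [cite: Kato2004, Thm 18.4 (p. 281)] -/
theorem bsd_of_orderTransferLE_of_lowerBoundHigh
    (hKato : ∀ (W : WeierstrassCurve ℚ) [W.IsElliptic] [W.IsGloballyMinimal] (p : ℕ)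
      [Fact p.Prime] {N : ℕ} [NeZero N] {f : CuspForm (Gamma0 N) 2},
      kato_mordellWeilRank_le_order_padicLFunction W p (f := f))
    (hmod : exists_isNewformOf)
    (hGZK : rank_eq_analyticRank_of_analyticRank_le_one)
    (hOT : OrderTransferLEHigh)
    (hlow : ∀ W : WeierstrassCurve ℚ, W.IsElliptic → 2 ≤ W.analyticRank →
      W.analyticRank ≤ W.mordellWeilRank) :
    _root_.BirchSwinnertonDyer := by
  intro W hE
  refine le_antisymm ?_ (mordellWeilRank_le_analyticRank_of_orderTransferLE hKato hmod hGZK hOT W hE)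
  by_cases ha : W.analyticRank ≤ 1
  · exact (rank_eq_of_le_one hGZK W ha).ge
  exact hlow W hE (by omega)

/-- The coarse form: `BirchSwinnertonDyer ⟸ OrderTransferLE ∧ LowerBound`. [cite: Kato2004, Thm 18.4 (p. 281)] -/
theorem bsd_of_orderTransferLE_of_lowerBound
    (hKato : ∀ (W : WeierstrassCurve ℚ) [W.IsElliptic] [W.IsGloballyMinimal] (p : ℕ)
      [Fact p.Prime] {N : ℕ} [NeZero N] {f : CuspForm (Gamma0 N) 2},
      kato_mordellWeilRank_le_order_padicLFunction W p (f := f))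
    (hmod : exists_isNewformOf)
    (hGZK : rank_eq_analyticRank_of_analyticRank_le_one)
    (hOT : OrderTransferLE)
    (hlow : ∀ W : WeierstrassCurve ℚ, W.IsElliptic → W.analyticRank ≤ W.mordellWeilRank) :
    _root_.BirchSwinnertonDyer :=
  bsd_of_orderTransferLE_of_lowerBoundHigh hKato hmod hGZK (fun W _ _ _ _ f hf _ _ => hOT W f hf)
    fun W hE _ => hlow W hE

end Squeeze

/-! ### The converse bookkeeping: what the summit gives back on the `p`-adic side

`BirchSwinnertonDyer` + Kato's bound give `ord_{s=1} L ≤ ord_{T=0} L_p` at EVERY odd good ordinary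
prime — the inequality opposite to `OrderTransferLE`.  So the summit pins the `p`-adic order from
below, never from above: `OrderTransferLE` is extra, `p`-adic, information (it follows from the
`p`-adic BSD conjecture of Mazur–Tate–Teitelbaum, or from BSD + finiteness of `Ш[p^∞]` +
non-degeneracy of the cyclotomic `p`-adic height + the main conjecture, by Schneider's theorem). -/

/-- Under the summit, Kato's bound reads `ord_{s=1} L(E,s) ≤ ord_{T=0} L_p(E,T)` at every odd
good ordinary prime. [cite: Kato2004, Thm 18.4 (p. 281)] -/
theorem analyticRank_le_order_padicLFunction_of_bsd
    (hKato : ∀ (W : WeierstrassCurve ℚ) [W.IsElliptic] [W.IsGloballyMinimal] (p : ℕ)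
      [Fact p.Prime] {N : ℕ} [NeZero N] {f : CuspForm (Gamma0 N) 2},
      kato_mordellWeilRank_le_order_padicLFunction W p (f := f))
    (hbsd : _root_.BirchSwinnertonDyer)
    (W : WeierstrassCurve ℚ) [hE : W.IsElliptic] [W.IsGloballyMinimal] (p : ℕ) [Fact p.Prime]
    {N : ℕ} [NeZero N] (f : CuspForm (Gamma0 N) 2) (hf : IsNewformOf W f)
    (hp : p ≠ 2) (hord : IsOrdinaryAt W p) :
    (W.analyticRank : ℕ∞) ≤ (padicLFunction f (unitRoot W p : ℚ_[p])).order := by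
  have h := hKato W p hp hord hf
  rwa [← hbsd W hE] at h

end Summit.BirchSwinnertonDyer.BirchSwinnertonDyer.Theorems.SoloBlind
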